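import Summits.QuantumFields.YangMills.Theorems.VirialFluxGapSharpTwistedLaplaceQuantitativeLaplaceMethod
import Summits.QuantumFields.YangMills.Theorems.VirialFluxGapSharpTwistedLaplaceDetBounds
import HarnessLib

/-!
# Laplace's method with an explicit, dimension-polynomial remainder `O(β^{−1/2})` from CUBIC data only
# (no parity, no fourth derivatives — the order-3 jets suffice; LEAD ym-line-sfw-p2 g97's «optional generic brick» for W4;
# free-hands support of ⟨stmt-QuantumFields-24197⟩ `SwapVirialDeficit.SwapGluedStiffness`)

The Euclidean core ✓`laplaceMethod_quantitative` (w2 g49) gives `O(1/β)` but needs the cubic Taylor FORM (odd) separated from a QUARTIC remainder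
(`|r| ≤ A₄‖y‖⁴`), i.e. fourth-order jets of the phase.  On a STEEP window (`β ≥ L^N`, LEAD g97 memo (R1)) any power rate serves, and the model side has
the THIRD-order jets (fcl-p3 g47 ✓`realJet3_chartDeficit_gnomonic_le`).  This file is the `β^{−1/2}` core from third-order data alone:

★★ `laplaceMethod_quantitative_cubic`.  `V` an `m`-dimensional real inner-product space, `A` symmetric `λ`-coercive, on the ball `‖y‖ ≤ R` a phase
`½⟪Ay,y⟫ + ρ(y)` and an amplitude `1 + η(y)` with ONLY `|ρ(y)| ≤ A₃‖y‖³`, `|η(y)| ≤ D‖y‖` (measurable; no parity), smallness `A₃R ≤ λ/(8(m+8))`, `DR ≤ 1`.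
Then for every `β > 0`
  `|∫_{‖y‖≤R} e^{−β(½⟪Ay,y⟫ + ρ)}(1 + η) dy − 𝔊(β)| ≤ (K₃/√β + 16(m+8)/(λR²β))·𝔊(β)`,  `𝔊(β) = (2π/β)^{m/2}/√det A`,
  `K₃ = 16A₃(m+8)/λ + 256A₃(m+8)²/λ² + D + 8D(m+8)/λ` — polynomial in the dimension and the data; no `β`/data coupling.
Proof: pointwise `|e^{−β(q+ρ)}(1+η) − e^{−βq}| ≤ (2β|ρ| + |η|)e^{−(1−τ)βq}` (`τ = 2A₃R/λ ≤ 1/(4(m+8))`), then `‖y‖³ ≤ ‖y‖²/(2r) + r‖y‖⁴/2` and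
`‖y‖ ≤ 1/(2r) + r‖y‖²/2` (AM–GM with the free scale `r = √β`), the dimension-explicit Gaussian moments ✓`integral_pow_mul_exp_neg_le` (`k = 0, 1, 2`) and the
tail ✓`laplace_tail_le`.  ★ `laplaceMethod_quantitative_cubic_of_eqOn` — consumer form (`f`, `w` agreeing with the model on the ball, `w₀ ≥ 0`).

HONEST FRAMING: classical real analysis; width 0 by itself toward any lattice statement; ⟨24197⟩, ⟨24196⟩, ⟨24194⟩, ⟨24497⟩ and every rung ∕ summit statement stay
OPEN; own crux ⟨22884⟩ OPEN (blocked-on ⟨19935⟩); the Yang–Mills mass gap is NOT proved; no summit is proved by a line.  Width seat ym-line-sfw-p2-w2 g58 (cell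
ym-idea-1, free hands), `--supports stmt-QuantumFields-24197`.  THEOREMS ONLY (0 `def`, 0 `sorry`), standard axioms.

## References
* K. W. Breitung, *Asymptotic Approximations for Probability Integrals*, LNM 1592 (1994), Thm 41 p. 56, Lemma 39–40 p. 55. [Breitung1994]
-/

set_option autoImplicit false

noncomputable section

open _root_.MeasureTheory _root_.Filter _root_.Set _root_.Module _root_.Metric
open scoped _root_.Topology _root_.Real _root_.InnerProductSpace

namespace Summit.QuantumFields.YangMills.Theorems.QuantitativeLaplace

open Literature.Analysis.Asymptotics
open Literature.Analysis.UnboundedOperators (abs_exp_sub_one_le_abs_mul_exp_abs)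

variable {V : Type*} [NormedAddCommGroup V] [InnerProductSpace ℝ V] [FiniteDimensional ℝ V]
  [MeasurableSpace V] [BorelSpace V]
variable {A : V →ₗ[ℝ] V} {lam : ℝ}

/-! ## §1 The pointwise bound from cubic data, with a free scale `r > 0` -/
set_option maxHeartbeats 400000 in
omit [FiniteDimensional ℝ V] [MeasurableSpace V] [BorelSpace V] in
/-- **Pointwise**: on the ball, `|e^{−β(q+ρ)}(1+η) − e^{−βq}| ≤ [(2βA₃/(λr))·q + (4βA₃r/λ²)·q² + D/(2r) + (Dr/λ)·q]·e^{−(1−τ)βq}`,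
`q = ½⟪Ay,y⟫`, `τ = 2A₃R/λ`, for every `r > 0`. [cite: Breitung1994, Thm 41 proof p. 57] -/
theorem laplace_cubic_pointwise_le (hlam : 0 < lam) (hcoer : ∀ y : V, lam * ‖y‖ ^ 2 ≤ ⟪A y, y⟫_ℝ)
    {R A₃ D β r : ℝ} (hA₃ : 0 ≤ A₃) (hD : 0 ≤ D) (hβ : 0 < β) (hr : 0 < r) (hDR : D * R ≤ 1)
    {ρ η : V → ℝ} (hρ : ∀ y : V, ‖y‖ ≤ R → |ρ y| ≤ A₃ * ‖y‖ ^ 3) (hη : ∀ y : V, ‖y‖ ≤ R → |η y| ≤ D * ‖y‖)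
    (y : V) (hy : ‖y‖ ≤ R) :
    |Real.exp (-(β * (((1 / 2) * ⟪A y, y⟫_ℝ) + ρ y))) * (1 + η y) - Real.exp (-(β * ((1 / 2) * ⟪A y, y⟫_ℝ)))| ≤
      (2 * β * A₃ / (lam * r)) * (((1 / 2) * ⟪A y, y⟫_ℝ) ^ 1 * Real.exp (-((1 - 2 * (A₃ * R) / lam) * β * ((1 / 2) * ⟪A y, y⟫_ℝ)))) +
      (4 * β * A₃ * r / lam ^ 2) * (((1 / 2) * ⟪A y, y⟫_ℝ) ^ 2 * Real.exp (-((1 - 2 * (A₃ * R) / lam) * β * ((1 / 2) * ⟪A y, y⟫_ℝ)))) +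
      (D / (2 * r)) * (((1 / 2) * ⟪A y, y⟫_ℝ) ^ 0 * Real.exp (-((1 - 2 * (A₃ * R) / lam) * β * ((1 / 2) * ⟪A y, y⟫_ℝ)))) +
      (D * r / lam) * (((1 / 2) * ⟪A y, y⟫_ℝ) ^ 1 * Real.exp (-((1 - 2 * (A₃ * R) / lam) * β * ((1 / 2) * ⟪A y, y⟫_ℝ)))) := by
  set q : ℝ := (1 / 2) * ⟪A y, y⟫_ℝ with hq
  set τ : ℝ := 2 * (A₃ * R) / lam with hτ
  set E : ℝ := Real.exp (-((1 - τ) * β * q)) with hE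
  have hq0 : 0 ≤ q := half_inner_nonneg_of_coercive hlam hcoer y
  have hyq : ‖y‖ ^ 2 ≤ (2 / lam) * q := norm_sq_le_of_coercive hlam hcoer y
  have hy0 : 0 ≤ ‖y‖ := norm_nonneg y
  have hR0 : 0 ≤ R := hy0.trans hy
  have hE0 : 0 < E := Real.exp_pos _
  -- `β|ρ| ≤ τβq`
  have hρq : |ρ y| ≤ τ * q := by
    have h1 := hρ y hy
    have h2 : ‖y‖ ^ 3 ≤ R * ‖y‖ ^ 2 := by
      have : ‖y‖ ^ 3 = ‖y‖ * ‖y‖ ^ 2 := by ring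
      rw [this]; exact mul_le_mul_of_nonneg_right hy (by positivity)
    calc |ρ y| ≤ A₃ * ‖y‖ ^ 3 := h1
      _ ≤ A₃ * (R * ((2 / lam) * q)) := by gcongr; exact h2.trans (mul_le_mul_of_nonneg_left hyq hR0)
      _ = τ * q := by rw [hτ]; field_simp
  have hηle : |η y| ≤ 1 := (hη y hy).trans ((mul_le_mul_of_nonneg_left hy hD).trans hDR)
  -- factor `e^{−βq}`
  have hfac : Real.exp (-(β * (q + ρ y))) * (1 + η y) - Real.exp (-(β * q)) =
      Real.exp (-(β * q)) * (Real.exp (-(β * ρ y)) * (1 + η y) - 1) := by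
    rw [show -(β * (q + ρ y)) = -(β * q) + -(β * ρ y) by ring, Real.exp_add]; ring
  have hinner : |Real.exp (-(β * ρ y)) * (1 + η y) - 1| ≤ 2 * (β * |ρ y|) * Real.exp (β * |ρ y|) + |η y| := by
    have e1 : Real.exp (-(β * ρ y)) * (1 + η y) - 1 = (Real.exp (-(β * ρ y)) - 1) * (1 + η y) + η y := by ring
    rw [e1]
    have h1 : |Real.exp (-(β * ρ y)) - 1| ≤ |-(β * ρ y)| * Real.exp |-(β * ρ y)| := abs_exp_sub_one_le_abs_mul_exp_abs _
    rw [abs_neg, abs_mul, abs_of_pos hβ] at h1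
    have h2 : |1 + η y| ≤ 2 := by
      have := abs_add_le (1 : ℝ) (η y); rw [abs_one] at this; linarith
    calc |(Real.exp (-(β * ρ y)) - 1) * (1 + η y) + η y| ≤ |(Real.exp (-(β * ρ y)) - 1) * (1 + η y)| + |η y| := abs_add_le _ _
      _ = |Real.exp (-(β * ρ y)) - 1| * |1 + η y| + |η y| := by rw [abs_mul]
      _ ≤ (β * |ρ y| * Real.exp (β * |ρ y|)) * 2 + |η y| := by gcongr
      _ = 2 * (β * |ρ y|) * Real.exp (β * |ρ y|) + |η y| := by ring
  -- combine: `e^{−βq}·e^{β|ρ|} ≤ E`, `e^{−βq} ≤ E`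
  have hexp1 : Real.exp (-(β * q)) * Real.exp (β * |ρ y|) ≤ E := by
    rw [← Real.exp_add, hE, Real.exp_le_exp]
    have := mul_le_mul_of_nonneg_left hρq hβ.le
    nlinarith
  have hexp2 : Real.exp (-(β * q)) ≤ E := by
    rw [hE, Real.exp_le_exp]
    have hτ0 : 0 ≤ τ := by rw [hτ]; positivity
    nlinarith [mul_nonneg (mul_nonneg hτ0 hβ.le) hq0]
  have hmain : |Real.exp (-(β * (q + ρ y))) * (1 + η y) - Real.exp (-(β * q))| ≤ 2 * β * A₃ * ‖y‖ ^ 3 * E + D * ‖y‖ * E := by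
    rw [hfac, abs_mul, abs_of_pos (Real.exp_pos _)]
    calc Real.exp (-(β * q)) * |Real.exp (-(β * ρ y)) * (1 + η y) - 1|
        ≤ Real.exp (-(β * q)) * (2 * (β * |ρ y|) * Real.exp (β * |ρ y|) + |η y|) := mul_le_mul_of_nonneg_left hinner (Real.exp_pos _).le
      _ = 2 * (β * |ρ y|) * (Real.exp (-(β * q)) * Real.exp (β * |ρ y|)) + |η y| * Real.exp (-(β * q)) := by ring
      _ ≤ 2 * (β * (A₃ * ‖y‖ ^ 3)) * E + (D * ‖y‖) * E := by
          gcongr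
          · exact hρ y hy
          · exact hη y hy
      _ = 2 * β * A₃ * ‖y‖ ^ 3 * E + D * ‖y‖ * E := by ring
  -- AM–GM with the free scale `r`
  have h3 : ‖y‖ ^ 3 ≤ q / (lam * r) + 2 * r * q ^ 2 / lam ^ 2 := by
    have a1 : 2 * r * ‖y‖ ^ 3 ≤ ‖y‖ ^ 2 + r ^ 2 * ‖y‖ ^ 4 := by nlinarith [sq_nonneg (r * ‖y‖ ^ 2 - ‖y‖)]
    have a2 : ‖y‖ ^ 4 ≤ (2 / lam) ^ 2 * q ^ 2 := by
      have := pow_le_pow_left₀ (by positivity) hyq 2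
      rw [← pow_mul] at this; simpa [mul_pow] using this
    have a3 : 2 * r * ‖y‖ ^ 3 ≤ (2 / lam) * q + r ^ 2 * ((2 / lam) ^ 2 * q ^ 2) := by nlinarith [mul_le_mul_of_nonneg_left a2 (sq_nonneg r)]
    rw [show q / (lam * r) + 2 * r * q ^ 2 / lam ^ 2 = ((2 / lam) * q + r ^ 2 * ((2 / lam) ^ 2 * q ^ 2)) / (2 * r) by field_simp]
    rw [le_div_iff₀ (by positivity)]
    linarith
  have h1 : ‖y‖ ≤ 1 / (2 * r) + r * q / lam := by
    have a1 : 2 * r * ‖y‖ ≤ 1 + r ^ 2 * ‖y‖ ^ 2 := by nlinarith [sq_nonneg (r * ‖y‖ - 1)]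
    have a3 : 2 * r * ‖y‖ ≤ 1 + r ^ 2 * ((2 / lam) * q) := by nlinarith [mul_le_mul_of_nonneg_left hyq (sq_nonneg r)]
    rw [show 1 / (2 * r) + r * q / lam = (1 + r ^ 2 * ((2 / lam) * q)) / (2 * r) by field_simp]
    rw [le_div_iff₀ (by positivity)]
    linarith
  calc |Real.exp (-(β * (q + ρ y))) * (1 + η y) - Real.exp (-(β * q))|
      ≤ 2 * β * A₃ * ‖y‖ ^ 3 * E + D * ‖y‖ * E := hmain
    _ ≤ 2 * β * A₃ * (q / (lam * r) + 2 * r * q ^ 2 / lam ^ 2) * E + D * (1 / (2 * r) + r * q / lam) * E := by gcongr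
    _ = _ := by simp only [pow_one, pow_zero, one_mul]; ring

omit [FiniteDimensional ℝ V] [MeasurableSpace V] [BorelSpace V] in
/-- On the ball the cubic-data integrand is bounded by `2`. [folklore] -/
theorem laplace_cubic_abs_integrand_le_two (hlam : 0 < lam) (hcoer : ∀ y : V, lam * ‖y‖ ^ 2 ≤ ⟪A y, y⟫_ℝ)
    {R A₃ D β : ℝ} (hA₃ : 0 ≤ A₃) (hD : 0 ≤ D) (hβ : 0 < β)
    (hsmall : A₃ * R ≤ lam / (8 * ((finrank ℝ V : ℝ) + 8))) (hDR : D * R ≤ 1)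
    {ρ η : V → ℝ} (hρ : ∀ y : V, ‖y‖ ≤ R → |ρ y| ≤ A₃ * ‖y‖ ^ 3) (hη : ∀ y : V, ‖y‖ ≤ R → |η y| ≤ D * ‖y‖)
    (y : V) (hy : ‖y‖ ≤ R) :
    |Real.exp (-(β * (((1 / 2) * ⟪A y, y⟫_ℝ) + ρ y))) * (1 + η y)| ≤ 2 := by
  set q : ℝ := (1 / 2) * ⟪A y, y⟫_ℝ with hq
  have hq0 : 0 ≤ q := half_inner_nonneg_of_coercive hlam hcoer y
  have hyq : ‖y‖ ^ 2 ≤ (2 / lam) * q := norm_sq_le_of_coercive hlam hcoer y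
  have hy0 : 0 ≤ ‖y‖ := norm_nonneg y
  have hR0 : 0 ≤ R := hy0.trans hy
  have hm0 : (0 : ℝ) ≤ (finrank ℝ V : ℝ) := Nat.cast_nonneg _
  have hηle : |η y| ≤ 1 := (hη y hy).trans ((mul_le_mul_of_nonneg_left hy hD).trans hDR)
  -- `|ρ| ≤ q/2`, so the phase is `≥ q/2 ≥ 0`
  have hρq : |ρ y| ≤ q / 2 := by
    have h1 := hρ y hy
    have h2 : ‖y‖ ^ 3 ≤ R * ‖y‖ ^ 2 := by
      have : ‖y‖ ^ 3 = ‖y‖ * ‖y‖ ^ 2 := by ring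
      rw [this]; exact mul_le_mul_of_nonneg_right hy (by positivity)
    have h3 : A₃ * R ≤ lam / 4 := hsmall.trans (by
      rw [div_le_div_iff₀ (by positivity) (by norm_num)]; nlinarith)
    have hA₃R : A₃ * ‖y‖ ^ 3 ≤ A₃ * R * ‖y‖ ^ 2 := by
      have := mul_le_mul_of_nonneg_left h2 hA₃
      linarith [this]
    calc |ρ y| ≤ A₃ * ‖y‖ ^ 3 := h1
      _ ≤ A₃ * R * ‖y‖ ^ 2 := hA₃R
      _ ≤ (lam / 4) * ((2 / lam) * q) := mul_le_mul h3 hyq (by positivity) (by positivity)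
      _ = q / 2 := by field_simp; ring
  have hphase : 0 ≤ β * (q + ρ y) := by
    have := neg_abs_le (ρ y)
    exact mul_nonneg hβ.le (by linarith)
  rw [abs_mul, abs_of_pos (Real.exp_pos _)]
  have he : Real.exp (-(β * (q + ρ y))) ≤ 1 := by rw [Real.exp_le_one_iff]; linarith
  have h2 : |1 + η y| ≤ 2 := by
    have := abs_add_le (1 : ℝ) (η y); rw [abs_one] at this; linarith
  calc Real.exp (-(β * (q + ρ y))) * |1 + η y| ≤ 1 * 2 := mul_le_mul he h2 (abs_nonneg _) zero_le_one
    _ = 2 := by norm_num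

/-! ## §2 The remainder integral and the theorem -/

/-- **The cubic remainder integrates to `O(β^{−1/2})·𝔊(β)`**: with `r = √β` in §1 and the Gaussian moments `k = 0, 1, 2`,
`∫_{‖y‖≤R} |e^{−β(q+ρ)}(1+η) − e^{−βq}| ≤ (16A₃(m+8)/λ + 256A₃(m+8)²/λ² + D + 8D(m+8)/λ)/√β · 𝔊(β)`. [cite: Breitung1994, Thm 41 proof p. 57] -/
theorem laplace_cubic_remainder_integral_le (hA : A.IsSymmetric) (hlam : 0 < lam)
    (hcoer : ∀ y : V, lam * ‖y‖ ^ 2 ≤ ⟪A y, y⟫_ℝ)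
    {R A₃ D β : ℝ} (hA₃ : 0 ≤ A₃) (hD : 0 ≤ D) (hβ : 0 < β)
    (hsmall : A₃ * R ≤ lam / (8 * ((finrank ℝ V : ℝ) + 8))) (hDR : D * R ≤ 1)
    {ρ η : V → ℝ} (hρ_meas : Measurable ρ) (hη_meas : Measurable η)
    (hρ : ∀ y : V, ‖y‖ ≤ R → |ρ y| ≤ A₃ * ‖y‖ ^ 3) (hη : ∀ y : V, ‖y‖ ≤ R → |η y| ≤ D * ‖y‖) :
    ∫ y in closedBall (0 : V) R, |Real.exp (-(β * (((1 / 2) * ⟪A y, y⟫_ℝ) + ρ y))) * (1 + η y) - Real.exp (-(β * ((1 / 2) * ⟪A y, y⟫_ℝ)))| ≤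
      (16 * A₃ * ((finrank ℝ V : ℝ) + 8) / lam + 256 * A₃ * ((finrank ℝ V : ℝ) + 8) ^ 2 / lam ^ 2 + D + 8 * D * ((finrank ℝ V : ℝ) + 8) / lam) /
        Real.sqrt β * ((2 * π / β) ^ ((finrank ℝ V : ℝ) / 2) / Real.sqrt (LinearMap.det A)) := by
  set M : ℝ := ((finrank ℝ V : ℝ) + 8) with hM
  set 𝔊 : ℝ := ((2 * π / β) ^ ((finrank ℝ V : ℝ) / 2) / Real.sqrt (LinearMap.det A)) with h𝔊
  set B : Set V := closedBall (0 : V) R with hB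
  set τ : ℝ := 2 * (A₃ * R) / lam with hτ
  set r : ℝ := Real.sqrt β with hr
  have hrpos : 0 < r := Real.sqrt_pos.2 hβ
  have hr2 : r * r = β := Real.mul_self_sqrt hβ.le
  have hm0 : (0 : ℝ) ≤ (finrank ℝ V : ℝ) := Nat.cast_nonneg _
  have hMpos : 0 < M := by rw [hM]; positivity
  have hq0 : ∀ y : V, 0 ≤ ((1 / 2) * ⟪A y, y⟫_ℝ) := fun y => half_inner_nonneg_of_coercive hlam hcoer y
  have hτle : τ ≤ 1 / (4 * M) := by
    rw [hτ, hM, div_le_div_iff₀ hlam (by positivity)]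
    have := hsmall; rw [le_div_iff₀ (by positivity)] at this
    nlinarith
  have h1τ : 1 - 1 / (4 * ((finrank ℝ V : ℝ) + 8)) ≤ 1 - τ := by rw [← hM]; linarith
  have h1τpos : 0 < (1 - τ) * β := by
    have : τ ≤ 1 / 32 := hτle.trans (by rw [div_le_div_iff₀ (by positivity) (by norm_num)]; rw [hM]; linarith)
    have : 0 < 1 - τ := by linarith
    positivity
  -- the four moment integrands and their integrability
  have hint : ∀ k : ℕ, Integrable fun y : V => ((1 / 2) * ⟪A y, y⟫_ℝ) ^ k * Real.exp (-((1 - τ) * β * ((1 / 2) * ⟪A y, y⟫_ℝ))) :=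
    fun k => integrable_pow_mul_exp_neg_mul_half_inner hlam hcoer k h1τpos
  have hmom : ∀ k : ℕ, ∫ y : V, ((1 / 2) * ⟪A y, y⟫_ℝ) ^ k * Real.exp (-((1 - τ) * β * ((1 / 2) * ⟪A y, y⟫_ℝ))) ≤
      2 * k.factorial * (4 * M / β) ^ k * 𝔊 := fun k => by
    rw [hM, h𝔊]; exact integral_pow_mul_exp_neg_le hA hlam hcoer k hβ h1τ
  set g : V → ℝ := fun y =>
      (2 * β * A₃ / (lam * r)) * (((1 / 2) * ⟪A y, y⟫_ℝ) ^ 1 * Real.exp (-((1 - τ) * β * ((1 / 2) * ⟪A y, y⟫_ℝ)))) +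
      (4 * β * A₃ * r / lam ^ 2) * (((1 / 2) * ⟪A y, y⟫_ℝ) ^ 2 * Real.exp (-((1 - τ) * β * ((1 / 2) * ⟪A y, y⟫_ℝ)))) +
      (D / (2 * r)) * (((1 / 2) * ⟪A y, y⟫_ℝ) ^ 0 * Real.exp (-((1 - τ) * β * ((1 / 2) * ⟪A y, y⟫_ℝ)))) +
      (D * r / lam) * (((1 / 2) * ⟪A y, y⟫_ℝ) ^ 1 * Real.exp (-((1 - τ) * β * ((1 / 2) * ⟪A y, y⟫_ℝ)))) with hgdef
  have hgint : Integrable g :=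
    ((((hint 1).const_mul _).add ((hint 2).const_mul _)).add ((hint 0).const_mul _)).add ((hint 1).const_mul _)
  have hg0 : ∀ y, 0 ≤ g y := fun y => by
    simp only [hgdef]; have := hq0 y; positivity
  -- pointwise on the ball, then extend to `V`
  have hBm : MeasurableSet B := by rw [hB]; exact measurableSet_closedBall
  have hBfin : volume B ≠ ⊤ := by rw [hB]; exact measure_closedBall_lt_top.ne
  have hq_meas : Measurable fun y : V => ((1 / 2) * ⟪A y, y⟫_ℝ) := (continuous_half_inner A).measurable
  have hF_meas : Measurable fun y : V =>
      |Real.exp (-(β * (((1 / 2) * ⟪A y, y⟫_ℝ) + ρ y))) * (1 + η y) - Real.exp (-(β * ((1 / 2) * ⟪A y, y⟫_ℝ)))| :=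
    (((((hq_meas.add hρ_meas).const_mul β).neg.exp).mul (measurable_const.add hη_meas)).sub ((hq_meas.const_mul β).neg.exp)).abs
  have hFB : IntegrableOn (fun y : V =>
      |Real.exp (-(β * (((1 / 2) * ⟪A y, y⟫_ℝ) + ρ y))) * (1 + η y) - Real.exp (-(β * ((1 / 2) * ⟪A y, y⟫_ℝ)))|) B :=
    Measure.integrableOn_of_bounded (M := 3) hBfin hF_meas.aestronglyMeasurable
      ((ae_restrict_iff' hBm).mpr (Eventually.of_forall fun y hy => by
        rw [Real.norm_eq_abs, abs_abs]
        have h2 := laplace_cubic_abs_integrand_le_two hlam hcoer hA₃ hD hβ hsmall hDR hρ hη y (by simpa [hB] using hy)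
        have h1 : |Real.exp (-(β * ((1 / 2) * ⟪A y, y⟫_ℝ)))| ≤ 1 := by
          rw [abs_of_pos (Real.exp_pos _), Real.exp_le_one_iff]; have := hq0 y; nlinarith
        calc |Real.exp (-(β * (((1 / 2) * ⟪A y, y⟫_ℝ) + ρ y))) * (1 + η y) - Real.exp (-(β * ((1 / 2) * ⟪A y, y⟫_ℝ)))|
            ≤ |Real.exp (-(β * (((1 / 2) * ⟪A y, y⟫_ℝ) + ρ y))) * (1 + η y)| + |Real.exp (-(β * ((1 / 2) * ⟪A y, y⟫_ℝ)))| := abs_sub _ _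
          _ ≤ 2 + 1 := add_le_add h2 h1
          _ = 3 := by norm_num))
  have hstep1 : ∫ y in B, |Real.exp (-(β * (((1 / 2) * ⟪A y, y⟫_ℝ) + ρ y))) * (1 + η y) - Real.exp (-(β * ((1 / 2) * ⟪A y, y⟫_ℝ)))| ≤
      ∫ y in B, g y :=
    setIntegral_mono_on hFB hgint.integrableOn hBm fun y hy =>
      laplace_cubic_pointwise_le hlam hcoer hA₃ hD hβ hrpos hDR hρ hη y (by simpa [hB] using hy)
  have hstep2 : ∫ y in B, g y ≤ ∫ y, g y := setIntegral_le_integral hgint (Eventually.of_forall hg0)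
  -- evaluate `∫ g` through the moments
  have hsum : ∫ y, g y =
      (2 * β * A₃ / (lam * r)) * (∫ y : V, ((1 / 2) * ⟪A y, y⟫_ℝ) ^ 1 * Real.exp (-((1 - τ) * β * ((1 / 2) * ⟪A y, y⟫_ℝ)))) +
      (4 * β * A₃ * r / lam ^ 2) * (∫ y : V, ((1 / 2) * ⟪A y, y⟫_ℝ) ^ 2 * Real.exp (-((1 - τ) * β * ((1 / 2) * ⟪A y, y⟫_ℝ)))) +
      (D / (2 * r)) * (∫ y : V, ((1 / 2) * ⟪A y, y⟫_ℝ) ^ 0 * Real.exp (-((1 - τ) * β * ((1 / 2) * ⟪A y, y⟫_ℝ)))) +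
      (D * r / lam) * (∫ y : V, ((1 / 2) * ⟪A y, y⟫_ℝ) ^ 1 * Real.exp (-((1 - τ) * β * ((1 / 2) * ⟪A y, y⟫_ℝ)))) := by
    simp only [hgdef]
    rw [integral_add, integral_add, integral_add, integral_const_mul, integral_const_mul, integral_const_mul, integral_const_mul]
    · exact ((hint 1).const_mul _)
    · exact ((hint 2).const_mul _)
    · exact (((hint 1).const_mul _).add ((hint 2).const_mul _))
    · exact ((hint 0).const_mul _)
    · exact ((((hint 1).const_mul _).add ((hint 2).const_mul _)).add ((hint 0).const_mul _))
    · exact ((hint 1).const_mul _)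
  have hm1 := hmom 1
  have hm2 := hmom 2
  have hm0' := hmom 0
  simp only [pow_one, Nat.factorial_one, Nat.cast_one, mul_one] at hm1
  simp only [pow_zero, Nat.factorial_zero, Nat.cast_one, mul_one] at hm0'
  simp only [Nat.factorial_two, Nat.cast_ofNat] at hm2
  have h𝔊0 : 0 ≤ 𝔊 := by
    rw [h𝔊]
    have : 0 < Real.sqrt (LinearMap.det A) :=
      Real.sqrt_pos.2 (lt_of_lt_of_le (pow_pos hlam _) (pow_le_det_of_coercive hA hlam.le hcoer))
    positivity
  -- the four terms
  have c1 : 0 ≤ 2 * β * A₃ / (lam * r) := by positivity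
  have c2 : 0 ≤ 4 * β * A₃ * r / lam ^ 2 := by positivity
  have c3 : 0 ≤ D / (2 * r) := by positivity
  have c4 : 0 ≤ D * r / lam := by positivity
  have hval : ∫ y, g y ≤ (2 * β * A₃ / (lam * r)) * (2 * (4 * M / β) * 𝔊) + (4 * β * A₃ * r / lam ^ 2) * (2 * 2 * (4 * M / β) ^ 2 * 𝔊) +
      (D / (2 * r)) * (2 * 𝔊) + (D * r / lam) * (2 * (4 * M / β) * 𝔊) := by
    rw [hsum]
    simp only [pow_one, pow_zero, one_mul] at hm1 hm0' ⊢
    gcongr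
  -- simplify with `r² = β`
  have hfinal : (2 * β * A₃ / (lam * r)) * (2 * (4 * M / β) * 𝔊) + (4 * β * A₃ * r / lam ^ 2) * (2 * 2 * (4 * M / β) ^ 2 * 𝔊) +
      (D / (2 * r)) * (2 * 𝔊) + (D * r / lam) * (2 * (4 * M / β) * 𝔊) =
      (16 * A₃ * M / lam + 256 * A₃ * M ^ 2 / lam ^ 2 + D + 8 * D * M / lam) / r * 𝔊 := by
    rw [← hr2]
    field_simp
    ring
  calc ∫ y in B, |Real.exp (-(β * (((1 / 2) * ⟪A y, y⟫_ℝ) + ρ y))) * (1 + η y) - Real.exp (-(β * ((1 / 2) * ⟪A y, y⟫_ℝ)))|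
      ≤ ∫ y, g y := hstep1.trans hstep2
    _ ≤ _ := hval
    _ = _ := hfinal

/-- ★★ **Laplace's method with an explicit, dimension-polynomial `O(β^{−1/2})` remainder from CUBIC data** (no parity, no quartic term):
`|∫_{‖y‖≤R} e^{−β(½⟪Ay,y⟫ + ρ)}(1 + η) − 𝔊(β)| ≤ (K₃/√β + 16(m+8)/(λR²β))·𝔊(β)`, `K₃ = 16A₃(m+8)/λ + 256A₃(m+8)²/λ² + D + 8D(m+8)/λ`.
[cite: Breitung1994, Thm 41 p. 56] -/
theorem laplaceMethod_quantitative_cubic (hA : A.IsSymmetric) (hlam : 0 < lam)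
    (hcoer : ∀ y : V, lam * ‖y‖ ^ 2 ≤ ⟪A y, y⟫_ℝ)
    {R A₃ D β : ℝ} (hR : 0 < R) (hA₃ : 0 ≤ A₃) (hD : 0 ≤ D) (hβ : 0 < β)
    (hsmall : A₃ * R ≤ lam / (8 * ((finrank ℝ V : ℝ) + 8))) (hDR : D * R ≤ 1)
    {ρ η : V → ℝ} (hρ_meas : Measurable ρ) (hη_meas : Measurable η)
    (hρ : ∀ y : V, ‖y‖ ≤ R → |ρ y| ≤ A₃ * ‖y‖ ^ 3) (hη : ∀ y : V, ‖y‖ ≤ R → |η y| ≤ D * ‖y‖) :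
    |(∫ y in closedBall (0 : V) R, Real.exp (-(β * (((1 / 2) * ⟪A y, y⟫_ℝ) + ρ y))) * (1 + η y)) -
        ((2 * π / β) ^ ((finrank ℝ V : ℝ) / 2) / Real.sqrt (LinearMap.det A))| ≤
      ((16 * A₃ * ((finrank ℝ V : ℝ) + 8) / lam + 256 * A₃ * ((finrank ℝ V : ℝ) + 8) ^ 2 / lam ^ 2 + D + 8 * D * ((finrank ℝ V : ℝ) + 8) / lam) /
          Real.sqrt β + 16 * ((finrank ℝ V : ℝ) + 8) / (lam * R ^ 2) / β) *
        ((2 * π / β) ^ ((finrank ℝ V : ℝ) / 2) / Real.sqrt (LinearMap.det A)) := by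
  set M : ℝ := ((finrank ℝ V : ℝ) + 8) with hM
  set 𝔊 : ℝ := ((2 * π / β) ^ ((finrank ℝ V : ℝ) / 2) / Real.sqrt (LinearMap.det A)) with h𝔊
  set B : Set V := closedBall (0 : V) R with hB
  have hm0 : (0 : ℝ) ≤ (finrank ℝ V : ℝ) := Nat.cast_nonneg _
  have hq0 : ∀ y : V, 0 ≤ ((1 / 2) * ⟪A y, y⟫_ℝ) := fun y => half_inner_nonneg_of_coercive hlam hcoer y
  have hq_meas : Measurable fun y : V => ((1 / 2) * ⟪A y, y⟫_ℝ) := (continuous_half_inner A).measurable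
  have hg_meas : Measurable fun y : V => Real.exp (-(β * (((1 / 2) * ⟪A y, y⟫_ℝ) + ρ y))) * (1 + η y) :=
    (((hq_meas.add hρ_meas).const_mul β).neg.exp).mul (measurable_const.add hη_meas)
  have hBfin : volume B ≠ ⊤ := by rw [hB]; exact measure_closedBall_lt_top.ne
  have hBm : MeasurableSet B := by rw [hB]; exact measurableSet_closedBall
  have hgB : IntegrableOn (fun y : V => Real.exp (-(β * (((1 / 2) * ⟪A y, y⟫_ℝ) + ρ y))) * (1 + η y)) B :=
    Measure.integrableOn_of_bounded hBfin hg_meas.aestronglyMeasurable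
      ((ae_restrict_iff' hBm).mpr (Eventually.of_forall fun y hy => by
        rw [Real.norm_eq_abs]
        exact laplace_cubic_abs_integrand_le_two hlam hcoer hA₃ hD hβ hsmall hDR hρ hη y (by simpa [hB] using hy)))
  have hg₀int : Integrable (fun y : V => Real.exp (-(β * ((1 / 2) * ⟪A y, y⟫_ℝ)))) := integrable_exp_neg_mul_half_inner hlam hcoer hβ
  have hg₀B : IntegrableOn (fun y : V => Real.exp (-(β * ((1 / 2) * ⟪A y, y⟫_ℝ)))) B := hg₀int.integrableOn
  -- split
  have hI2 : IntegrableOn (fun y : V => Real.exp (-(β * (((1 / 2) * ⟪A y, y⟫_ℝ) + ρ y))) * (1 + η y) - Real.exp (-(β * ((1 / 2) * ⟪A y, y⟫_ℝ)))) B :=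
    hgB.sub hg₀B
  have hsplit : (∫ y in B, Real.exp (-(β * (((1 / 2) * ⟪A y, y⟫_ℝ) + ρ y))) * (1 + η y)) =
      (∫ y in B, Real.exp (-(β * ((1 / 2) * ⟪A y, y⟫_ℝ)))) +
        ∫ y in B, (Real.exp (-(β * (((1 / 2) * ⟪A y, y⟫_ℝ) + ρ y))) * (1 + η y) - Real.exp (-(β * ((1 / 2) * ⟪A y, y⟫_ℝ)))) := by
    rw [← integral_add hg₀B hI2]
    congr 1; funext y; ring
  have h𝔊int : ∫ y : V, Real.exp (-(β * ((1 / 2) * ⟪A y, y⟫_ℝ))) = 𝔊 := by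
    rw [h𝔊]; exact integral_exp_neg_mul_half_inner hA hlam hcoer hβ
  have htail_split : (∫ y in B, Real.exp (-(β * ((1 / 2) * ⟪A y, y⟫_ℝ)))) + ∫ y in Bᶜ, Real.exp (-(β * ((1 / 2) * ⟪A y, y⟫_ℝ))) = 𝔊 := by
    rw [integral_add_compl hBm hg₀int, h𝔊int]
  have htail0 : 0 ≤ ∫ y in Bᶜ, Real.exp (-(β * ((1 / 2) * ⟪A y, y⟫_ℝ))) := integral_nonneg fun y => (Real.exp_pos _).le
  have htail : ∫ y in Bᶜ, Real.exp (-(β * ((1 / 2) * ⟪A y, y⟫_ℝ))) ≤ 16 * M / (lam * R ^ 2) / β * 𝔊 := by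
    rw [hB, hM, h𝔊]; exact laplace_tail_le hA hlam hcoer hR hβ
  have hrem : |∫ y in B, (Real.exp (-(β * (((1 / 2) * ⟪A y, y⟫_ℝ) + ρ y))) * (1 + η y) - Real.exp (-(β * ((1 / 2) * ⟪A y, y⟫_ℝ))))| ≤
      (16 * A₃ * M / lam + 256 * A₃ * M ^ 2 / lam ^ 2 + D + 8 * D * M / lam) / Real.sqrt β * 𝔊 := by
    refine abs_integral_le_integral_abs.trans ?_
    rw [hB, hM, h𝔊]
    exact laplace_cubic_remainder_integral_le hA hlam hcoer hA₃ hD hβ hsmall hDR hρ_meas hη_meas hρ hη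
  have hfinal : (∫ y in B, Real.exp (-(β * (((1 / 2) * ⟪A y, y⟫_ℝ) + ρ y))) * (1 + η y)) - 𝔊 =
      (∫ y in B, (Real.exp (-(β * (((1 / 2) * ⟪A y, y⟫_ℝ) + ρ y))) * (1 + η y) - Real.exp (-(β * ((1 / 2) * ⟪A y, y⟫_ℝ))))) -
        ∫ y in Bᶜ, Real.exp (-(β * ((1 / 2) * ⟪A y, y⟫_ℝ))) := by
    rw [hsplit]; linarith
  rw [hfinal]
  calc |(∫ y in B, (Real.exp (-(β * (((1 / 2) * ⟪A y, y⟫_ℝ) + ρ y))) * (1 + η y) - Real.exp (-(β * ((1 / 2) * ⟪A y, y⟫_ℝ))))) -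
          ∫ y in Bᶜ, Real.exp (-(β * ((1 / 2) * ⟪A y, y⟫_ℝ)))|
      ≤ |∫ y in B, (Real.exp (-(β * (((1 / 2) * ⟪A y, y⟫_ℝ) + ρ y))) * (1 + η y) - Real.exp (-(β * ((1 / 2) * ⟪A y, y⟫_ℝ))))| +
          |∫ y in Bᶜ, Real.exp (-(β * ((1 / 2) * ⟪A y, y⟫_ℝ)))| := abs_sub _ _
    _ ≤ (16 * A₃ * M / lam + 256 * A₃ * M ^ 2 / lam ^ 2 + D + 8 * D * M / lam) / Real.sqrt β * 𝔊 + 16 * M / (lam * R ^ 2) / β * 𝔊 := by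
        rw [abs_of_nonneg htail0]; exact add_le_add hrem htail
    _ = _ := by ring

/-- ★ **Consumer form**: a phase `f` and a weight `w` that agree on the ball with `½⟪Ay,y⟫ + ρ` and `w₀(1 + η)` (`w₀ ≥ 0`):
`|∫_{‖y‖≤R} e^{−βf} w − w₀𝔊(β)| ≤ (K₃/√β + 16(m+8)/(λR²β))·w₀𝔊(β)`. [cite: Breitung1994, Thm 41 p. 56] -/
theorem laplaceMethod_quantitative_cubic_of_eqOn (hA : A.IsSymmetric) (hlam : 0 < lam)
    (hcoer : ∀ y : V, lam * ‖y‖ ^ 2 ≤ ⟪A y, y⟫_ℝ)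
    {R A₃ D β w₀ : ℝ} (hR : 0 < R) (hA₃ : 0 ≤ A₃) (hD : 0 ≤ D) (hβ : 0 < β) (hw₀ : 0 ≤ w₀)
    (hsmall : A₃ * R ≤ lam / (8 * ((finrank ℝ V : ℝ) + 8))) (hDR : D * R ≤ 1)
    {f w ρ η : V → ℝ} (hρ_meas : Measurable ρ) (hη_meas : Measurable η)
    (hρ : ∀ y : V, ‖y‖ ≤ R → |ρ y| ≤ A₃ * ‖y‖ ^ 3) (hη : ∀ y : V, ‖y‖ ≤ R → |η y| ≤ D * ‖y‖)
    (hf : ∀ y : V, ‖y‖ ≤ R → f y = (1 / 2) * ⟪A y, y⟫_ℝ + ρ y)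
    (hw : ∀ y : V, ‖y‖ ≤ R → w y = w₀ * (1 + η y)) :
    |(∫ y in closedBall (0 : V) R, Real.exp (-(β * f y)) * w y) - w₀ * ((2 * π / β) ^ ((finrank ℝ V : ℝ) / 2) / Real.sqrt (LinearMap.det A))| ≤
      ((16 * A₃ * ((finrank ℝ V : ℝ) + 8) / lam + 256 * A₃ * ((finrank ℝ V : ℝ) + 8) ^ 2 / lam ^ 2 + D + 8 * D * ((finrank ℝ V : ℝ) + 8) / lam) /
          Real.sqrt β + 16 * ((finrank ℝ V : ℝ) + 8) / (lam * R ^ 2) / β) *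
        (w₀ * ((2 * π / β) ^ ((finrank ℝ V : ℝ) / 2) / Real.sqrt (LinearMap.det A))) := by
  have h := laplaceMethod_quantitative_cubic hA hlam hcoer hR hA₃ hD hβ hsmall hDR hρ_meas hη_meas hρ hη
  have hcongr : ∫ y in closedBall (0 : V) R, Real.exp (-(β * f y)) * w y =
      w₀ * ∫ y in closedBall (0 : V) R, Real.exp (-(β * (((1 / 2) * ⟪A y, y⟫_ℝ) + ρ y))) * (1 + η y) := by
    rw [← integral_const_mul]
    refine setIntegral_congr_fun measurableSet_closedBall fun y hy => ?_
    have hyR : ‖y‖ ≤ R := by simpa using hy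
    rw [hf y hyR, hw y hyR]; ring
  rw [hcongr, ← mul_sub, abs_mul, abs_of_nonneg hw₀]
  calc w₀ * |(∫ y in closedBall (0 : V) R, Real.exp (-(β * (((1 / 2) * ⟪A y, y⟫_ℝ) + ρ y))) * (1 + η y)) -
          ((2 * π / β) ^ ((finrank ℝ V : ℝ) / 2) / Real.sqrt (LinearMap.det A))|
      ≤ w₀ * (((16 * A₃ * ((finrank ℝ V : ℝ) + 8) / lam + 256 * A₃ * ((finrank ℝ V : ℝ) + 8) ^ 2 / lam ^ 2 + D +
            8 * D * ((finrank ℝ V : ℝ) + 8) / lam) / Real.sqrt β + 16 * ((finrank ℝ V : ℝ) + 8) / (lam * R ^ 2) / β) *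
          ((2 * π / β) ^ ((finrank ℝ V : ℝ) / 2) / Real.sqrt (LinearMap.det A))) := mul_le_mul_of_nonneg_left h hw₀
    _ = _ := by ring

end Summit.QuantumFields.YangMills.Theorems.QuantitativeLaplace

end
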